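import Summits.AtomisticToContinuum.Crystallization.Theorems.FrustratedLawDichotomyAtlasDoorTransport
import Summits.AtomisticToContinuum.Crystallization.Theorems.FrustratedLawDichotomyPullKernel

/-!
# FrustratedLawDichotomy · crux `AperiodicFrustratedLawGap` (stmt-AtomisticToContinuum-27623) — THE ATLAS DOOR WITH THE ZONE PULL KERNEL PLUGGED IN
# (decomp-a2c, RESIDUAL lens-5 «finite/base range + asymptotic regime + bridge», generation 114; r1848 (C) kernel and dials of record, GO (325) door + GO (329) kernel)

One junction, no mathematics: the transported atlas door (228′) `…AtlasDoorTransport.aperiodicFrustratedLawGap_of_atlasTransport` instantiated at the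
kernel pair OF RECORD `(F, G) = (0, zonePull Hm 8)` of `…PullKernel`, with the four kernel clauses `hF`, `hG`, `hBF/hFb`, `hBG/hGb` DISCHARGED
(`measurable_zero_kernel`, `measurable_zonePull hmeas`, `lintegral_outflow_zero_kernel_le`, `exists_outflow_bound_zonePull`).  What the atlas programme
then supplies for the route decl `AperiodicFrustratedLawGap` is exactly: a jointly measurable covariant mark `Hm` («host-like», hand-2's `HostLikeAt`), the
finite row list `K, mK` with transported floors `e⋆ + m_i ≤ rootEnergy + net 0 (zonePull Hm 8)` (class A/H rows via `…PullKernel.floor_add_net_of_floor`,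
class Z rows via `…PullKernel.floor_add_net_of_floor_outflow`), and the ONE residual inequality `ResidualCoreDeficitT n K mK 0 (zonePull Hm 8)`.
Imports: (325) `…AtlasDoorTransport`, (329) `…PullKernel`; 0 sorry.  Tags: [new: junction].
-/

noncomputable section

namespace Summit.AtomisticToContinuum.Crystallization.Theorems.FrustratedLawDichotomyAtlasDoorPull

open MeasureTheory Metric Set Filter
open scoped ENNReal Topology BigOperators
open Literature.MathematicalPhysics.StatisticalMechanics Literature.Probability.Process
open Summit.AtomisticToContinuum.Crystallization.Theorems.ChargedEnergyGapNegative (E3 eStar)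
open Summit.AtomisticToContinuum.Crystallization.Theorems.FrustratedLawDichotomySignedLedger (net)
open Summit.AtomisticToContinuum.Crystallization.Theorems.FrustratedLawDichotomyAtlasDoorTransport
  (ResidualCoreDeficitT aperiodicFrustratedLawGap_of_atlasTransport)
open Summit.AtomisticToContinuum.Crystallization.Theorems.FrustratedLawDichotomyPullKernel
  (zonePull measurable_zonePull exists_outflow_bound_zonePull measurable_zero_kernel lintegral_outflow_zero_kernel_le)

/-- **THE ATLAS DOOR AT THE KERNEL OF RECORD.**  For a jointly measurable mark `Hm` (pull radius `8`), a finite list of measurable row cells `K i` with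
booked margins `m_i` and TRANSPORTED deterministic floors `e⋆ + m_i ≤ rootEnergy V_LJ μ + net 0 (zonePull Hm 8) μ` at every rooted `7/10`-hard-core Nash
configuration of each row, plus the transported residual inequality, the route decl `AperiodicFrustratedLawGap` holds. [new: junction] -/
theorem aperiodicFrustratedLawGap_of_atlasPull (Hm : Measure E3 → E3 → Prop) (hmeas : MeasurableSet {p : Measure E3 × E3 | Hm p.1 p.2})
    (n : ℕ) (K : ℕ → Set (Measure E3)) (hK : ∀ i, MeasurableSet (K i)) (mK : ℕ → ℝ)
    (hfloor : ∀ i < n, ∀ μ : MeasureTheory.Measure (EuclideanSpace ℝ (Fin 3)), Literature.Probability.Process.IsRootedHardCore (7 / 10) μ →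
      (∀ p : EuclideanSpace ℝ (Fin 3), μ {p} ≠ 0 → ∀ y : EuclideanSpace ℝ (Fin 3), (∀ q : EuclideanSpace ℝ (Fin 3), μ {q} ≠ 0 → q ≠ p → y ≠ q) → ∑' q : {q : EuclideanSpace ℝ (Fin 3) // μ {q} ≠ 0 ∧ q ≠ p}, Literature.MathematicalPhysics.StatisticalMechanics.lennardJones (dist p (q : EuclideanSpace ℝ (Fin 3))) ≤ ∑' q : {q : EuclideanSpace ℝ (Fin 3) // μ {q} ≠ 0 ∧ q ≠ p}, Literature.MathematicalPhysics.StatisticalMechanics.lennardJones (dist y (q : EuclideanSpace ℝ (Fin 3)))) → μ ∈ K i →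
      (⨅ Q : Literature.MathematicalPhysics.StatisticalMechanics.PeriodicConfiguration 3, Q.energyPerParticle Literature.MathematicalPhysics.StatisticalMechanics.lennardJones) + mK i ≤ Literature.MathematicalPhysics.StatisticalMechanics.rootEnergy Literature.MathematicalPhysics.StatisticalMechanics.lennardJones μ + net 0 (zonePull Hm 8) μ)
    (hres : ResidualCoreDeficitT n K mK 0 (zonePull Hm 8)) :
    Summit.AtomisticToContinuum.Crystallization.Theses.FrustratedLawDichotomy.AperiodicFrustratedLawGap := by
  obtain ⟨BG, hBG, hGb⟩ := exists_outflow_bound_zonePull (δ := 7 / 10) (by norm_num) Hm 8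
  exact aperiodicFrustratedLawGap_of_atlasTransport n K hK mK 0 (zonePull Hm 8) measurable_zero_kernel (measurable_zonePull hmeas)
    ENNReal.zero_ne_top hBG (fun μ _ => lintegral_outflow_zero_kernel_le μ 0) hGb hfloor hres

end Summit.AtomisticToContinuum.Crystallization.Theorems.FrustratedLawDichotomyAtlasDoorPull

end
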